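import Mathlib
import HarnessLib
import Literature.Analysis.FluidPDE.VorticityCalculus
import Literature.Analysis.FluidPDE.DivFreeVectorPotential
import Summits.NavierStokesRegularity.NavierStokesRegularity.Theorems.UnthreadedDoorPotentialEvolutionCore

/-!
# Route `UnthreadedDoor`, crux `PoloidalLiouville` (stmt-NavierStokesRegularity-1222), WALL W1 `stub_scalarLiouville` —
# crux idea «capsym-comparison» (ns-idea-13 g0), line input FL-C `CapSym.ZonalToroidalLiouville`: INDUCTION-EQUATION ALGEBRA

KEY-NS #150 (2) / DIRECTOR-NS #246 (4), step (1) of the FL-C handoff plan (`FLC-HANDOFF.md`, evidence on 1222): the curl of the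
potential-form equation `(∂ₜU + ⟪V,∇U⟫ − ΔU)·x = ⟪V,x⟫∇U − ∇Π`.  Two frozen-time bricks:

* `CapSym.cross_gradient_eq_of_potentialForm` — **curl of the potential form**: if `g₁·x = g₂ ∇U − ∇P` on `ℝ³`
  (`g₁, g₂` differentiable, `U, P ∈ C²`), then `∇g₁ × x = ∇g₂ × ∇U` (Leibniz `curl (φ F) = φ curl F + ∇φ × F`, `curl x = 0`,
  `curl ∇ = 0`) — the converse direction of FL-A, and the form in which the successor feeds `g₁ = ∂ₜU + ⟪V,∇U⟫ − ΔU`,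
  `g₂ = ⟪V, x⟫`;
* `CapSym.cross_adjoint_add_eq_zero` — **the trace-free cofactor identity** `Mᵀa × y + a × Mᵀy + M(a × y) = (tr M)(a × y) = 0` for a
  trace-free `M : ℝ³ →L ℝ³` — with `M = DV(x)` (`tr DV = div V = 0`) it is the algebra turning `∇⟪V,∇U⟫ × x − ∇⟪V,x⟫ × ∇U`
  into the transport–stretching terms `D(∇U × x)[V] − DV[∇U × x]` of the induction equation (step (1) of the plan);
* `CapSym.gradient_inner_eq_adjoint_add`, `CapSym.gradient_inner_self_eq_adjoint_add`, `CapSym.fderiv_cross_gradient_apply` — the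
  product rules `∇⟪V,W⟫ = DVᵀW + DWᵀV`, `∇⟪V,x⟫ = DVᵀx + V`, `D(∇U × x)[h] = (D∇U h) × x + ∇U × h`;
* `CapSym.adjoint_fderiv_gradient` (the Hessian is self-adjoint) and the assembled pointwise algebra
  `CapSym.cross_gradient_inner_sub_eq`: `∇⟪V,∇U⟫ × x − ∇⟪V,·⟫ × ∇U = D(∇U × ·)[V] − DV[∇U × x]` for `tr DV(x) = 0`.

WHAT THIS IS NOT: no NS-regularity statement is touched; FL-C is NOT proved here (see `FLC-HANDOFF.md`); `PoloidalLiouville`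
(1222), its wall and the summit stay OPEN.  `--supports stmt-NavierStokesRegularity-1222 --as helper`.
[cite: MajdaBertozziCUP2002, §1.1 (vector identities)] [cite: KochNadirashviliSereginSverak2009, §5 Thm 5.2]
-/

noncomputable section

-- the summit and its single sub-problem share the name (CONVENTIONS §1)
set_option linter.dupNamespace false

open Set Function Filter Topology InnerProductSpace
open scoped RealInnerProductSpace

namespace Summit.NavierStokesRegularity.NavierStokesRegularity.Theorems.PoloidalLiouville.CapSym

open Literature.Analysis Literature.Analysis.FluidPDE

/-! ### Curl of the potential form -/

/-- `curl (y ↦ y) = 0`. [folklore] -/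
theorem curl_self_eq_zero (x : EuclideanSpace ℝ (Fin 3)) :
    curl (fun y : EuclideanSpace ℝ (Fin 3) => y) x = 0 := by
  rw [curl_eq_curlCLM, curlCLM_apply]
  have h : fderiv ℝ (fun y : EuclideanSpace ℝ (Fin 3) => y) x = ContinuousLinearMap.id ℝ _ := fderiv_id
  rw [h]
  ext i
  fin_cases i <;> simp

/-- **Curl of the potential form.**  If `g₁(y)·y = g₂(y) ∇U(y) − ∇P(y)` for all `y ∈ ℝ³`, with `g₁, g₂` differentiable and
`U, P ∈ C²`, then `∇g₁(x) × x = ∇g₂(x) × ∇U(x)` for every `x` (`curl` of both sides: `curl (φ F) = φ curl F + ∇φ × F`,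
`curl (y ↦ y) = 0`, `curl ∇U = curl ∇P = 0`). [cite: MajdaBertozziCUP2002, §1.1 (vector identities)] -/
theorem cross_gradient_eq_of_potentialForm {g₁ g₂ U P : EuclideanSpace ℝ (Fin 3) → ℝ}
    (hg₁ : Differentiable ℝ g₁) (hg₂ : Differentiable ℝ g₂) (hU : ContDiff ℝ 2 U) (hP : ContDiff ℝ 2 P)
    (heq : ∀ y : EuclideanSpace ℝ (Fin 3), g₁ y • y = g₂ y • gradient U y - gradient P y)
    (x : EuclideanSpace ℝ (Fin 3)) :
    cross (gradient g₁ x) x = cross (gradient g₂ x) (gradient U x) := by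
  have hgrad : ∀ {W : EuclideanSpace ℝ (Fin 3) → ℝ}, ContDiff ℝ 2 W → Differentiable ℝ (gradient W) := by
    intro W hW
    have h1 : ContDiff ℝ 1 (gradient W) :=
      (InnerProductSpace.toDual ℝ (EuclideanSpace ℝ (Fin 3))).symm.contDiff.comp
        (hW.fderiv_right (m := 1) (by norm_num))
    exact h1.differentiable (by simp)
  have hfun : (fun y : EuclideanSpace ℝ (Fin 3) => g₁ y • y) =
      fun y => g₂ y • gradient U y - gradient P y := funext heq
  have hL : curl (fun y : EuclideanSpace ℝ (Fin 3) => g₁ y • y) x = cross (gradient g₁ x) x := by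
    rw [curl_smul (f := fun y : EuclideanSpace ℝ (Fin 3) => y) (hg₁ x) differentiableAt_id, curl_self_eq_zero,
      smul_zero, zero_add, curlCLM_smulRight]
    rfl
  have hR : curl (fun y : EuclideanSpace ℝ (Fin 3) => g₂ y • gradient U y - gradient P y) x =
      cross (gradient g₂ x) (gradient U x) := by
    have hd : DifferentiableAt ℝ (fun y : EuclideanSpace ℝ (Fin 3) => g₂ y • gradient U y) x :=
      (hg₂ x).smul ((hgrad hU) x)
    rw [curl_sub hd ((hgrad hP) x),
      curl_smul (hg₂ x) ((hgrad hU) x), curl_gradient_eq_zero_holds U hU x, curl_gradient_eq_zero_holds P hP x,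
      smul_zero, zero_add, sub_zero, curlCLM_smulRight]
    rfl
  rw [← hL, hfun, hR]

/-! ### The trace-free cofactor identity -/

/-- **Trace-free cofactor identity.**  For `M : ℝ³ →L ℝ³` with `tr M = Σₘ (M eₘ)ₘ = 0` and all `a, y`:
`Mᵀa × y + a × Mᵀy + M(a × y) = 0` (for a general `M` the right-hand side is `(tr M)(a × y)`; `Mᵀ = adjoint M`).
With `M = DV(x)`, `tr DV = div V = 0`, this is the algebra of the induction equation for `∇U × x` carried by `V`. [folklore] -/
theorem cross_adjoint_add_eq_zero (M : EuclideanSpace ℝ (Fin 3) →L[ℝ] EuclideanSpace ℝ (Fin 3))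
    (htr : ∑ m : Fin 3, M (EuclideanSpace.single m (1 : ℝ)) m = 0) (a y : EuclideanSpace ℝ (Fin 3)) :
    cross (ContinuousLinearMap.adjoint M a) y + cross a (ContinuousLinearMap.adjoint M y) + M (cross a y) = 0 := by
  -- coordinates of the transposes and of `M (a × y)`
  have hadj : ∀ (w : EuclideanSpace ℝ (Fin 3)) (i : Fin 3), ContinuousLinearMap.adjoint M w i =
      w 0 * M (EuclideanSpace.single i (1 : ℝ)) 0 + w 1 * M (EuclideanSpace.single i (1 : ℝ)) 1 +
        w 2 * M (EuclideanSpace.single i (1 : ℝ)) 2 := by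
    intro w i
    have h : ContinuousLinearMap.adjoint M w i = ⟪ContinuousLinearMap.adjoint M w, EuclideanSpace.single i (1 : ℝ)⟫ := by
      rw [EuclideanSpace.inner_single_right]; simp
    rw [h, ContinuousLinearMap.adjoint_inner_left, Tao2016.real_inner_fin3]
  have hc : ∀ k : Fin 3, M (cross a y) k = ∑ m, (cross a y) m * M (EuclideanSpace.single m (1 : ℝ)) k :=
    fun k => clm_apply_coord M (cross a y) k
  simp only [Fin.sum_univ_three] at htr hc
  refine PeriodicCylinder.ext3 ?_ ?_ ?_
  · rw [PiLp.add_apply, PiLp.add_apply, hc 0, cross_apply_zero, cross_apply_zero, hadj, hadj, hadj, hadj,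
      cross_apply_zero, cross_apply_one, cross_apply_two, PiLp.zero_apply]
    linear_combination (a 1 * y 2 - a 2 * y 1) * htr
  · rw [PiLp.add_apply, PiLp.add_apply, hc 1, cross_apply_one, cross_apply_one, hadj, hadj, hadj, hadj,
      cross_apply_zero, cross_apply_one, cross_apply_two, PiLp.zero_apply]
    linear_combination (a 2 * y 0 - a 0 * y 2) * htr
  · rw [PiLp.add_apply, PiLp.add_apply, hc 2, cross_apply_two, cross_apply_two, hadj, hadj, hadj, hadj,
      cross_apply_zero, cross_apply_one, cross_apply_two, PiLp.zero_apply]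
    linear_combination (a 0 * y 1 - a 1 * y 0) * htr

/-! ### Product rules feeding the induction equation -/

/-- **`∇⟪V, W⟫ = DVᵀ W + DWᵀ V`** at a point of differentiability (`ᵀ = adjoint`). [folklore] -/
theorem gradient_inner_eq_adjoint_add {V W : EuclideanSpace ℝ (Fin 3) → EuclideanSpace ℝ (Fin 3)}
    {x : EuclideanSpace ℝ (Fin 3)} (hV : DifferentiableAt ℝ V x) (hW : DifferentiableAt ℝ W x) :
    gradient (fun y => ⟪V y, W y⟫) x =
      ContinuousLinearMap.adjoint (fderiv ℝ V x) (W x) + ContinuousLinearMap.adjoint (fderiv ℝ W x) (V x) := by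
  refine ext_inner_right ℝ fun h => ?_
  rw [LocalHelmholtz.inner_gradient_left_eq_fderiv, fderiv_inner_apply ℝ hV hW, inner_add_left,
    ContinuousLinearMap.adjoint_inner_left, ContinuousLinearMap.adjoint_inner_left, real_inner_comm (W x)]
  ring

/-- **`∇⟪V, x⟫ = DVᵀ x + V`** at a point of differentiability. [folklore] -/
theorem gradient_inner_self_eq_adjoint_add {V : EuclideanSpace ℝ (Fin 3) → EuclideanSpace ℝ (Fin 3)}
    {x : EuclideanSpace ℝ (Fin 3)} (hV : DifferentiableAt ℝ V x) :
    gradient (fun y => ⟪V y, y⟫) x = ContinuousLinearMap.adjoint (fderiv ℝ V x) x + V x := by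
  have hid : DifferentiableAt ℝ (fun y : EuclideanSpace ℝ (Fin 3) => y) x := differentiableAt_id
  have h0 := gradient_inner_eq_adjoint_add (W := fun y : EuclideanSpace ℝ (Fin 3) => y) hV hid
  have h : fderiv ℝ (fun y : EuclideanSpace ℝ (Fin 3) => y) x = ContinuousLinearMap.id ℝ _ := fderiv_id
  rw [h, ContinuousLinearMap.adjoint_id, ContinuousLinearMap.id_apply] at h0
  exact h0

/-- **`D(∇U × x)[h] = (D∇U h) × x + ∇U × h`** for `U ∈ C²`. [folklore] -/
theorem fderiv_cross_gradient_apply {U : EuclideanSpace ℝ (Fin 3) → ℝ} (hU : ContDiff ℝ 2 U)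
    (x h : EuclideanSpace ℝ (Fin 3)) :
    fderiv ℝ (fun y : EuclideanSpace ℝ (Fin 3) => cross (gradient U y) y) x h =
      cross (fderiv ℝ (gradient U) x h) x + cross (gradient U x) h := by
  have h1 : ContDiff ℝ 1 (gradient U) :=
    (InnerProductSpace.toDual ℝ (EuclideanSpace ℝ (Fin 3))).symm.contDiff.comp (hU.fderiv_right (m := 1) (by norm_num))
  have hg : HasFDerivAt (gradient U) (fderiv ℝ (gradient U) x) x := ((h1.differentiable (by simp)) x).hasFDerivAt
  have hx : HasFDerivAt (fun y : EuclideanSpace ℝ (Fin 3) => y) (ContinuousLinearMap.id ℝ _) x := hasFDerivAt_id x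
  rw [(hasFDerivAt_cross hg hx).fderiv]
  simp only [_root_.add_apply, ContinuousLinearMap.precompR_apply, ContinuousLinearMap.precompL_apply,
    ContinuousLinearMap.compL_apply, ContinuousLinearMap.coe_comp, Function.comp_apply,
    ContinuousLinearMap.coe_id', id_eq, crossCLM_apply]
  rw [add_comm]

/-- **The Hessian is self-adjoint**: `(D∇U(x))ᵀ = D∇U(x)` for `U ∈ C²` (Schwarz). [folklore] -/
theorem adjoint_fderiv_gradient {U : EuclideanSpace ℝ (Fin 3) → ℝ} (hU : ContDiff ℝ 2 U) (x : EuclideanSpace ℝ (Fin 3)) :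
    ContinuousLinearMap.adjoint (fderiv ℝ (gradient U) x) = fderiv ℝ (gradient U) x := by
  have h1 : ContDiff ℝ 1 (gradient U) :=
    (InnerProductSpace.toDual ℝ (EuclideanSpace ℝ (Fin 3))).symm.contDiff.comp (hU.fderiv_right (m := 1) (by norm_num))
  have hgd : ∀ y, DifferentiableAt ℝ (gradient U) y := fun y => (h1.differentiable (by simp)) y
  have hTd : ∀ y, DifferentiableAt ℝ (fderiv ℝ U) y := fun y =>
    ((hU.fderiv_right (m := 1) (by norm_num)).differentiable (by simp)) y
  -- `⟪D∇U(x) h, k⟫ = D²U(x)(h)(k)`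
  have hhk : ∀ h k : EuclideanSpace ℝ (Fin 3), ⟪fderiv ℝ (gradient U) x h, k⟫ = fderiv ℝ (fderiv ℝ U) x h k := by
    intro h k
    have e1 : (fun y : EuclideanSpace ℝ (Fin 3) => ⟪gradient U y, k⟫) = fun y => fderiv ℝ U y k :=
      funext fun y => LocalHelmholtz.inner_gradient_left_eq_fderiv U y k
    have h2 : fderiv ℝ (fun y : EuclideanSpace ℝ (Fin 3) => ⟪gradient U y, k⟫) x h = ⟪fderiv ℝ (gradient U) x h, k⟫ := by
      rw [fderiv_inner_apply ℝ (hgd x) (differentiableAt_const k)]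
      simp [fderiv_fun_const]
    have h3 : fderiv ℝ (fun y : EuclideanSpace ℝ (Fin 3) => fderiv ℝ U y k) x h = fderiv ℝ (fderiv ℝ U) x h k := by
      rw [fderiv_clm_apply (hTd x) (differentiableAt_const k)]
      simp [fderiv_fun_const]
    rw [← h2, e1, h3]
  have hS : IsSymmSndFDerivAt ℝ U x := hU.contDiffAt.isSymmSndFDerivAt (by simp)
  refine ContinuousLinearMap.ext fun h => ext_inner_right ℝ fun k => ?_
  rw [ContinuousLinearMap.adjoint_inner_left, real_inner_comm, hhk, hhk, hS.eq]

/-- **The transport–stretching algebra of the induction equation** (pointwise): for `V` differentiable at `x` with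
`tr DV(x) = 0` (`= div V(x)`) and `U ∈ C²`,
`∇⟪V, ∇U⟫(x) × x − ∇⟪V, ·⟫(x) × ∇U(x) = D(∇U × ·)(x)[V x] − DV(x)[∇U(x) × x]`
(product rules + the self-adjoint Hessian + the trace-free cofactor identity).  With `cross_gradient_eq_of_potentialForm`
this is what turns the curl of the potential-form equation into `∂ₜB + DB[V] − DV[B] = ΔB` for `B = ∇U × x`. [folklore] -/
theorem cross_gradient_inner_sub_eq {V : EuclideanSpace ℝ (Fin 3) → EuclideanSpace ℝ (Fin 3)}
    {U : EuclideanSpace ℝ (Fin 3) → ℝ} {x : EuclideanSpace ℝ (Fin 3)} (hV : DifferentiableAt ℝ V x)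
    (htr : ∑ m : Fin 3, fderiv ℝ V x (EuclideanSpace.single m (1 : ℝ)) m = 0) (hU : ContDiff ℝ 2 U) :
    cross (gradient (fun y => ⟪V y, gradient U y⟫) x) x - cross (gradient (fun y => ⟪V y, y⟫) x) (gradient U x) =
      fderiv ℝ (fun y : EuclideanSpace ℝ (Fin 3) => cross (gradient U y) y) x (V x) -
        fderiv ℝ V x (cross (gradient U x) x) := by
  have h1 : ContDiff ℝ 1 (gradient U) :=
    (InnerProductSpace.toDual ℝ (EuclideanSpace ℝ (Fin 3))).symm.contDiff.comp (hU.fderiv_right (m := 1) (by norm_num))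
  have hgd : DifferentiableAt ℝ (gradient U) x := (h1.differentiable (by simp)) x
  have hcof := cross_adjoint_add_eq_zero (fderiv ℝ V x) htr (gradient U x) x
  rw [gradient_inner_eq_adjoint_add hV hgd, adjoint_fderiv_gradient hU x, gradient_inner_self_eq_adjoint_add hV,
    fderiv_cross_gradient_apply hU x (V x)]
  -- bilinearity of the cross product
  have e1 : cross (ContinuousLinearMap.adjoint (fderiv ℝ V x) (gradient U x) + fderiv ℝ (gradient U) x (V x)) x =
      cross (ContinuousLinearMap.adjoint (fderiv ℝ V x) (gradient U x)) x + cross (fderiv ℝ (gradient U) x (V x)) x := by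
    rw [← crossCLM_apply, map_add, _root_.add_apply]; rfl
  have e2 : cross (ContinuousLinearMap.adjoint (fderiv ℝ V x) x + V x) (gradient U x) =
      cross (ContinuousLinearMap.adjoint (fderiv ℝ V x) x) (gradient U x) + cross (V x) (gradient U x) := by
    rw [← crossCLM_apply, map_add, _root_.add_apply]; rfl
  have hswap : ∀ a b : EuclideanSpace ℝ (Fin 3), cross a b = -cross b a := fun a b => by
    simp only [cross]
    rw [← cross_anticomm, WithLp.toLp_neg]
  rw [hswap (gradient U x) (ContinuousLinearMap.adjoint (fderiv ℝ V x) x)] at hcof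
  have key := eq_neg_of_add_eq_zero_left hcof
  have key' : fderiv ℝ V x (cross (gradient U x) x) =
      -(cross (ContinuousLinearMap.adjoint (fderiv ℝ V x) (gradient U x)) x +
        -cross (ContinuousLinearMap.adjoint (fderiv ℝ V x) x) (gradient U x)) := by
    rw [key, neg_neg]
  rw [e1, e2, hswap (gradient U x) (V x), key']
  abel

end Summit.NavierStokesRegularity.NavierStokesRegularity.Theorems.PoloidalLiouville.CapSym

end
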